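import Literature.NumberTheory.EllipticCurves.FineSelmerCoefficientMapProofs
import Literature.NumberTheory.EllipticCurves.SubgroupSelmerCocycleCriteriaProofs
import Literature.NumberTheory.EllipticCurves.H1UnramifiedFinite
import Literature.NumberTheory.GaloisRepresentations.DecompositionGroupOfCompletion
import Literature.NumberTheory.GaloisRepresentations.IntegralGaloisActionProofs
import HarnessLib

/-!
# The fine Selmer group of a finite module over `K_∞` is finite as soon as the everywhere-unramified
# continuous homomorphisms on `Gal(K̄/K(M)·K_∞)` are finite (inflation–restriction to the trivialising
# subgroup; proved, no definition, no named fact)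

`Proofs` file in topic `NumberTheory/EllipticCurves` (namespace
`Literature.NumberTheory.EllipticCurves.FineSelmerTrivialisingRestriction`), written by the prover seat
`bsd-potss-k8t-c4` g21 (cell `bsd-potss`, K8-t′ route, item stmt-BirchSwinnertonDyer-19982; closes
nothing). First brick of the discharge, in the form the class-group μ-road doors consume, of the named fact
`CoatesSujatha2005.thm34_fineSelmerDual_moduleFinite_of_classicalMuVanishes_divisionField`
(Coates–Sujatha 2005, Thm. 3.4: class groups of the cyclotomic tower of `ℚ(E[p])` control statement (A)).

Setting: `K` a number field, `M` a finite discrete `Γ_K`-module with continuous action, `κ` a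
`ℤ_p`-extension of `K` (`H = Gal(K̄/K_∞) = κ.kerSubgroup`), `N = fixingSubgroupOfModule K M` the (open,
normal) kernel of the action, `U_∞ = N ⊓ H = Gal(K̄/K(M)·K_∞)`.

* §1 `exists_mem_primesAbove_of_isMaximal`, `exists_conj_mem_decomp_of_mem_decompositionSubgroup` — every
  maximal ideal `𝔓` of `\bar ℤ_K` lies above a finite place `v`, and its decomposition group is a
  `Γ_K`-conjugate of the tree's chosen one `GreenbergSelmer.decomp v` (transitivity
  `exists_smul_eq_of_mem_primesAbove_holds` + `decompositionSubgroup_adicCompletionPrime_eq_range`).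
* §2 `apply_eq_zero_of_mem_fineSelmerInfty` — a continuous crossed homomorphism `φ : H → M` whose class
  lies in `Sel₀(K_∞, M)` VANISHES at every `u ∈ U_∞` lying in the decomposition group of some maximal `𝔓`
  (the strict local condition at the place of `K_∞` below `𝔓`, read on the cocycle through
  `CocycleCriteria.conjH1_oneCocycleClass_mem_ker_resOfLe_iff`; `u` acts trivially on `M`).
* §3 `restrict_mem_unramifiedHoms_of_mem_fineSelmerInfty` — hence `φ|_{U_∞}` lies in the tree's
  `unramifiedHoms U_∞ M ∅` (`H1UnramifiedFinite`: continuous homomorphisms killing `I_𝔓 ∩ U_∞` for EVERY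
  prime `𝔓` of `\bar ℤ_K`).
* §4 **`finite_fineSelmerInfty_of_finite_unramifiedHoms`** — if `unramifiedHoms U_∞ M ∅` is finite then
  `Sel₀(K_∞, M)` is finite: a cocycle on `H` is determined by its restriction to `U_∞` and its values on
  coset representatives of the finite quotient `H/U_∞` (`N` is open, `H` is compact), exactly as in
  Silverman X.4.3 step 1 (`H1UnramifiedFinite.restrictCocycle_injective`) with `Γ_K` replaced by `H`.

With the Lim–Sujatha bricks of the tree (`LimSujatha2018.fineSelmerDual_moduleFinite_iff_finite_fineSelmerInfty_torsion`:
statement (A) ⟺ `Sel₀(K_∞, E[p])` finite) this reduces statement (A) for `E` at an odd `p` to the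
finiteness of `unramifiedHoms (Gal(K̄/K(E[p])·K_∞)) E[p] ∅`, which the sibling file bounds by the `p`-ranks
of the class groups of the layers `K(E[p])·K_n`.

References: [CoatesSujatha2005] §3 (Thm. 3.4 and its proof: restriction to `F_∞(E[p])`);
[SilvermanAEC2009] X.§4, proof of Lemma 4.3 (inflation–restriction on cocycles);
[SerreGaloisCohomology1997] I.§2.5, I.§5.8; [NeukirchANT1999] Ch. I §9 (conjugate decomposition groups).
-/

set_option autoImplicit false

noncomputable section

open scoped Classical Pointwise

universe u

namespace Literature.NumberTheory.EllipticCurves.FineSelmerTrivialisingRestriction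

open NumberField IsDedekindDomain Field
open Literature.NumberTheory.EllipticCurves Literature.NumberTheory.EllipticCurves.GreenbergSelmer
  Literature.NumberTheory.GaloisRepresentations

/-! ## §1 Maximal ideals of `\bar ℤ_K`: places below and conjugate decomposition groups -/

section Primes

variable {K : Type u} [Field K] [NumberField K]

/-- Every maximal ideal of `\bar ℤ_K` lies above a finite place of `K` (its contraction to `𝓞 K` is a
non-zero prime). [folklore] [cite: NeukirchANT1999, Ch. I §9 (before (9.1))] -/
theorem exists_mem_primesAbove_of_isMaximal (𝔓 : Ideal (absIntegers (𝓞 K) K)) [h𝔓 : 𝔓.IsMaximal] :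
    ∃ v : HeightOneSpectrum (𝓞 K), 𝔓 ∈ v.primesAbove := by
  haveI : (𝔓.under (𝓞 K)).IsMaximal := Ideal.IsMaximal.under (𝓞 K) 𝔓
  have hne : 𝔓.under (𝓞 K) ≠ ⊥ :=
    Ring.ne_bot_of_isMaximal_of_not_isField inferInstance (RingOfIntegers.not_isField K)
  exact ⟨⟨𝔓.under (𝓞 K), inferInstance, hne⟩, h𝔓.isPrime, ⟨rfl⟩⟩

/-- **The decomposition group of any maximal `𝔓` is conjugate into the chosen `D_v`.** For a maximal
ideal `𝔓` of `\bar ℤ_K` there are a finite place `v` and `g ∈ Γ_K` with `g⁻¹ σ g ∈ D_v`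
(`GreenbergSelmer.decomp v`, the decomposition group of the prime `𝔓₀ ∣ v` cut out by the chosen embedding
`K̄ → \bar K_v`) for every `σ` in the decomposition group of `𝔓`: `𝔓 = g • 𝔓₀` by transitivity and
`D_{g𝔓₀} = g D_{𝔓₀} g⁻¹`. [cite: NeukirchANT1999, Ch. I §9 Prop. (9.1) and the remark after (9.5)] -/
theorem exists_conj_mem_decomp_of_mem_decompositionSubgroup (𝔓 : Ideal (absIntegers (𝓞 K) K))
    [𝔓.IsMaximal] :
    ∃ (v : HeightOneSpectrum (𝓞 K)) (g : absoluteGaloisGroup K),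
      ∀ σ ∈ 𝔓.decompositionSubgroup (absoluteGaloisGroup K), g⁻¹ * σ * g ∈ decomp v := by
  obtain ⟨v, h𝔓⟩ := exists_mem_primesAbove_of_isMaximal 𝔓
  obtain ⟨g, hg⟩ := HeightOneSpectrum.exists_smul_eq_of_mem_primesAbove_holds
    (adicCompletionPrime_mem_primesAbove K v) h𝔓
  refine ⟨v, g, fun σ hσ ↦ ?_⟩
  rw [← hg, Ideal.decompositionSubgroup_smul, Subgroup.mem_pointwise_smul_iff_inv_smul_mem,
    MulAut.smul_def, MulAut.conj_inv_apply, decompositionSubgroup_adicCompletionPrime_eq_range] at hσ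
  exact hσ

end Primes

/-! ## §2 Cocycles with class in `Sel₀(K_∞, M)` vanish on `U_∞ ∩ D_𝔓` -/

section Vanishing

variable {K : Type u} [Field K] [NumberField K]
variable {M : Type u} [AddCommGroup M] [DistribMulAction (absoluteGaloisGroup K) M]
  [TopologicalSpace M] [DiscreteTopology M]
variable {p : ℕ} [Fact p.Prime] (κ : ZpExtension K p)

/-- **The strict local conditions on the cocycle.** Let `φ : H → M` (`H = Gal(K̄/K_∞)`) be a continuous
crossed homomorphism whose class lies in `Sel₀(K_∞, M)`, and let `u ∈ H` act trivially on `M`. If `u`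
lies in the decomposition group of a maximal ideal `𝔓` of `\bar ℤ_K`, then `φ u = 0`: with `g⁻¹ u g ∈ D_v`
(§1) the local condition at `v` for the conjugate `conj_{g⁻¹}[φ]` reads `g⁻¹ • φ(u) = (g⁻¹ u g) • a - a`
(`CocycleCriteria.conjH1_oneCocycleClass_mem_ker_resOfLe_iff`), and `(g⁻¹ u g) • a = a` since `u` fixes
`g • a`. [cite: CoatesSujatha2005, §3 (definition of `R(E/F_∞)`: classes locally trivial everywhere)]
[cite: SerreGaloisCohomology1997, I.§2.5 (conjugation on `H¹(H, M)`)] -/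
theorem apply_eq_zero_of_mem_fineSelmerInfty
    (φ : contOneCocycles (discreteTopRep κ.kerSubgroup M))
    (hφ : oneCocycleClass _ φ ∈ fineSelmerInfty M κ)
    (u : κ.kerSubgroup) (hu : (u : absoluteGaloisGroup K) ∈ fixingSubgroupOfModule K M)
    (𝔓 : Ideal (absIntegers (𝓞 K) K)) [𝔓.IsMaximal]
    (hu𝔓 : (u : absoluteGaloisGroup K) ∈ 𝔓.decompositionSubgroup (absoluteGaloisGroup K)) :
    φ.1 u = 0 := by
  obtain ⟨v, g, hg⟩ := exists_conj_mem_decomp_of_mem_decompositionSubgroup 𝔓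
  have hloc := ((FineSelmerCoefficientMap.mem_fineSelmerInfty_iff_resOfLe κ _).1 hφ).1 v g⁻¹
  obtain ⟨a, ha⟩ := (CocycleCriteria.conjH1_oneCocycleClass_mem_ker_resOfLe_iff
    (inf_le_left : κ.kerSubgroup ⊓ decomp v ≤ κ.kerSubgroup) g⁻¹ φ).1 hloc
  -- the element `x = g⁻¹ u g ∈ H ⊓ D_v`
  have hxH : g⁻¹ * (u : absoluteGaloisGroup K) * g ∈ κ.kerSubgroup := by
    simpa only [inv_inv] using (inferInstance : κ.kerSubgroup.Normal).conj_mem _ u.2 g⁻¹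
  have hxD : g⁻¹ * (u : absoluteGaloisGroup K) * g ∈ decomp v := hg _ hu𝔓
  have hx := ha ⟨g⁻¹ * (u : absoluteGaloisGroup K) * g, Subgroup.mem_inf.2 ⟨hxH, hxD⟩⟩
  -- `subgroupConj H g⁻¹ x = u`
  have hconj : subgroupConj κ.kerSubgroup g⁻¹
      (Subgroup.inclusion (inf_le_left : κ.kerSubgroup ⊓ decomp v ≤ κ.kerSubgroup)
        ⟨g⁻¹ * (u : absoluteGaloisGroup K) * g, Subgroup.mem_inf.2 ⟨hxH, hxD⟩⟩) = u := by
    apply Subtype.ext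
    simp only [subgroupConj_apply_coe, Subgroup.coe_inclusion, inv_inv]
    group
  rw [hconj] at hx
  -- `(g⁻¹ u g) • a = a` since `u ∈ N` fixes `g • a`
  have hfix : (g⁻¹ * (u : absoluteGaloisGroup K) * g) • a = a := by
    rw [mul_smul, mul_smul, smul_eq_of_mem_fixingSubgroupOfModule hu, inv_smul_smul]
  have h0 : g⁻¹ • φ.1 u = 0 := by rw [hx, hfix, sub_self]
  exact (smul_eq_zero_iff_eq g⁻¹).1 h0

/-- In particular such a cocycle vanishes on `U_∞ ∩ I_𝔓` for every prime `𝔓 ∣ v` of `\bar ℤ_K`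
(`I_𝔓 ≤ D_𝔓`). [cite: NeukirchANT1999, Ch. I §9 (9.6) (`I_𝔓 ⊆ G_𝔓`)] -/
theorem apply_eq_zero_of_mem_fineSelmerInfty_of_mem_inertia
    (φ : contOneCocycles (discreteTopRep κ.kerSubgroup M))
    (hφ : oneCocycleClass _ φ ∈ fineSelmerInfty M κ)
    (u : κ.kerSubgroup) (hu : (u : absoluteGaloisGroup K) ∈ fixingSubgroupOfModule K M)
    {v : HeightOneSpectrum (𝓞 K)} {𝔓 : Ideal (absIntegers (𝓞 K) K)} (h𝔓 : 𝔓 ∈ v.primesAbove)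
    (hu𝔓 : (u : absoluteGaloisGroup K) ∈ 𝔓.inertia (absoluteGaloisGroup K)) :
    φ.1 u = 0 := by
  haveI := HeightOneSpectrum.isMaximal_of_mem_primesAbove h𝔓
  exact apply_eq_zero_of_mem_fineSelmerInfty κ φ hφ u hu 𝔓
    (Ideal.inertia_le_decompositionSubgroup (absoluteGaloisGroup K) 𝔓 hu𝔓)

/-! ## §3 The restriction to `U_∞ = N ⊓ H` is an everywhere-unramified continuous homomorphism -/

/-- **`φ|_{U_∞} ∈ Hom(U_∞, M; ∅)`.** For a cocycle `φ` on `H = Gal(K̄/K_∞)` with class in `Sel₀(K_∞, M)`,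
the bare restriction `u ↦ φ u` to `U_∞ = N ⊓ H` (`N = fixingSubgroupOfModule K M`) is continuous,
additive (`N` acts trivially) and kills `I_𝔓 ∩ U_∞` for EVERY prime `𝔓` of `\bar ℤ_K` (§2), i.e. lies in
the tree's `unramifiedHoms (N ⊓ H) M ∅`. [cite: SilvermanAEC2009, Lemma X.4.3 (proof, step 1)]
[cite: CoatesSujatha2005, §3 (proof of Thm. 3.4: over `F_∞(E[p])` the fine Selmer classes are homomorphisms)] -/
theorem restrict_mem_unramifiedHoms_of_mem_fineSelmerInfty
    (φ : contOneCocycles (discreteTopRep κ.kerSubgroup M))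
    (hφ : oneCocycleClass _ φ ∈ fineSelmerInfty M κ) :
    (fun u : ↥(fixingSubgroupOfModule K M ⊓ κ.kerSubgroup) ↦
        φ.1 ⟨(u : absoluteGaloisGroup K), (Subgroup.mem_inf.1 u.2).2⟩) ∈
      unramifiedHoms (fixingSubgroupOfModule K M ⊓ κ.kerSubgroup) M
        (∅ : Set (HeightOneSpectrum (𝓞 K))) := by
  refine ⟨?_, fun σ τ ↦ ?_, fun v _ 𝔓 h𝔓 σ hσ ↦ ?_⟩
  · exact φ.1.continuous.comp (Continuous.subtype_mk continuous_subtype_val _)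
  · have hmul : (⟨((σ * τ : ↥(fixingSubgroupOfModule K M ⊓ κ.kerSubgroup)) : absoluteGaloisGroup K),
        (Subgroup.mem_inf.1 (σ * τ).2).2⟩ : κ.kerSubgroup) =
        ⟨(σ : absoluteGaloisGroup K), (Subgroup.mem_inf.1 σ.2).2⟩ *
          ⟨(τ : absoluteGaloisGroup K), (Subgroup.mem_inf.1 τ.2).2⟩ := rfl
    have hcoc := (mem_contOneCocycles_iff φ.1).1 φ.2
    simp only
    rw [hmul, hcoc, discreteTopRep_ρ_apply, Subgroup.smul_def]
    change φ.1 _ + (σ : absoluteGaloisGroup K) • φ.1 _ = _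
    rw [smul_eq_of_mem_fixingSubgroupOfModule (Subgroup.mem_inf.1 σ.2).1]
  · exact apply_eq_zero_of_mem_fineSelmerInfty_of_mem_inertia κ φ hφ _ (Subgroup.mem_inf.1 σ.2).1 h𝔓 hσ

/-! ## §4 Finiteness of `Sel₀(K_∞, M)` from finiteness of `Hom(U_∞, M; ∅)` -/

omit [NumberField K] in
/-- **A cocycle on `H` is determined by its restriction to `U_∞` and its values on coset
representatives of `H/U_∞`** (`φ (h u) = φ h + h • φ u`). [cite: SerreGaloisCohomology1997, I.§5.8 (proof of inflation–restriction)] -/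
theorem restrict_prod_injective :
    Function.Injective fun φ : contOneCocycles (discreteTopRep κ.kerSubgroup M) ↦
      ((fun u : ↥(fixingSubgroupOfModule K M ⊓ κ.kerSubgroup) ↦
          φ.1 ⟨(u : absoluteGaloisGroup K), (Subgroup.mem_inf.1 u.2).2⟩),
        fun q : κ.kerSubgroup ⧸ (fixingSubgroupOfModule K M ⊓ κ.kerSubgroup).subgroupOf κ.kerSubgroup ↦
          φ.1 q.out) := by
  intro c c' hcc'
  simp only [Prod.mk.injEq] at hcc'
  obtain ⟨hU, hQ⟩ := hcc'
  set V := (fixingSubgroupOfModule K M ⊓ κ.kerSubgroup).subgroupOf κ.kerSubgroup with hV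
  apply Subtype.ext
  ext g
  obtain ⟨u, hu⟩ := QuotientGroup.mk_out_eq_mul V g
  have hg : g = (QuotientGroup.mk g : κ.kerSubgroup ⧸ V).out * ((u⁻¹ : V) : κ.kerSubgroup) := by
    rw [hu, Subgroup.coe_inv, mul_inv_cancel_right]
  have huN : (((u⁻¹ : V) : κ.kerSubgroup) : absoluteGaloisGroup K) ∈
      fixingSubgroupOfModule K M ⊓ κ.kerSubgroup := Subgroup.mem_subgroupOf.1 (u⁻¹).2
  have hcu : c.1 ((u⁻¹ : V) : κ.kerSubgroup) = c'.1 ((u⁻¹ : V) : κ.kerSubgroup) := by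
    exact congr_fun hU ⟨(((u⁻¹ : V) : κ.kerSubgroup) : absoluteGaloisGroup K), huN⟩
  rw [hg, (mem_contOneCocycles_iff c.1).1 c.2, (mem_contOneCocycles_iff c'.1).1 c'.2,
    congr_fun hQ (QuotientGroup.mk g), hcu]

/-- **`Sel₀(K_∞, M)` is finite if `Hom(Gal(K̄/K(M)·K_∞), M; ∅)` is finite.** For a number field `K`, a
finite discrete `Γ_K`-module `M` with continuous action and a `ℤ_p`-extension `κ`: the continuous cocycles
on `H = Gal(K̄/K_∞)` with class in `Sel₀(K_∞, M)` inject (§4) into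
`unramifiedHoms (N ⊓ H) M ∅ × M^{H/(N ⊓ H)}` (§3; `N = fixingSubgroupOfModule K M` is open, `H` is compact,
so `H/(N ⊓ H)` is finite), and every class is represented (`oneCocycleClass_surjective`). This is the
inflation–restriction step `H¹(F_∞, E[p]) → Hom(Gal(\bar F/F_∞(E[p])), E[p])` (finite kernel) of the proof of
Coates–Sujatha's Thm. 3.4. [cite: CoatesSujatha2005, Thm. 3.4 (proof)] [cite: SilvermanAEC2009, Lemma X.4.3 (proof, step 1)] -/
theorem finite_fineSelmerInfty_of_finite_unramifiedHoms [Finite M]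
    [ContinuousSMul (absoluteGaloisGroup K) M]
    (hfin : (unramifiedHoms (fixingSubgroupOfModule K M ⊓ κ.kerSubgroup) M
      (∅ : Set (HeightOneSpectrum (𝓞 K)))).Finite) :
    (fineSelmerInfty M κ : Set (subgroupH1 κ.kerSubgroup M)).Finite := by
  set N := fixingSubgroupOfModule K M with hNdef
  set H := κ.kerSubgroup with hHdef
  set V : Subgroup H := (N ⊓ H).subgroupOf H with hVdef
  -- `V` is open in the compact group `H`, so `H/V` is finite
  have hNopen : IsOpen (N : Set (absoluteGaloisGroup K)) := isOpen_fixingSubgroupOfModule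
  haveI : CompactSpace H := isCompact_iff_compactSpace.mp κ.isClosed_kerSubgroup.isCompact
  have hVopen : IsOpen (V : Set H) := by
    have : (V : Set H) = Subtype.val ⁻¹' (N : Set (absoluteGaloisGroup K)) := by
      ext x
      simp only [hVdef, SetLike.mem_coe, Subgroup.mem_subgroupOf, Subgroup.mem_inf, Set.mem_preimage]
      exact ⟨fun h ↦ h.1, fun h ↦ ⟨h, x.2⟩⟩
    rw [this]
    exact hNopen.preimage continuous_subtype_val
  haveI : Finite (H ⧸ V) := Subgroup.quotient_finite_of_isOpen V hVopen
  -- the cocycles with class in `Sel₀` form a finite set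
  have hZ : {φ : contOneCocycles (discreteTopRep κ.kerSubgroup M) |
      oneCocycleClass _ φ ∈ fineSelmerInfty M κ}.Finite := by
    have hprod : ((unramifiedHoms (N ⊓ H) M (∅ : Set (HeightOneSpectrum (𝓞 K)))) ×ˢ
        (Set.univ : Set (H ⧸ V → M))).Finite := hfin.prod Set.finite_univ
    refine Set.Finite.of_finite_image (hprod.subset ?_) (restrict_prod_injective κ).injOn
    rintro _ ⟨φ, hφ, rfl⟩
    exact ⟨restrict_mem_unramifiedHoms_of_mem_fineSelmerInfty κ φ hφ, Set.mem_univ _⟩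
  have hsub : (fineSelmerInfty M κ : Set (subgroupH1 κ.kerSubgroup M)) ⊆
      oneCocycleClass (discreteTopRep κ.kerSubgroup M) ''
        {φ | oneCocycleClass _ φ ∈ fineSelmerInfty M κ} := by
    intro x hx
    obtain ⟨φ, rfl⟩ := oneCocycleClass_surjective _ x
    exact ⟨φ, hx, rfl⟩
  exact (hZ.image _).subset hsub

end Vanishing

end Literature.NumberTheory.EllipticCurves.FineSelmerTrivialisingRestriction

end
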